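import Mathlib
import HarnessLib
import Summits.ValiantsHypothesis.ValiantsHypothesis.Theorems.KPlusLogSqLawMixedGaugeTwoClassAllRatios

/-!
# Route «KPlusLogSqLaw», `WeakLifting` (stmt-ValiantsHypothesis-19561) — mixed-gauge series: the remaining exponent pairs —
# `a > b`: at most `m + 2n` distinct positive roots (block-swap symmetry); `a = b`: at most `n + m` (generalized eigenvalue problem)

HONEST FRAMING.  Helper file (hand leafhand-val-kpluslogsqlaw-1 g14, 2026-08-31; `--supports stmt-ValiantsHypothesis-19561 --as helper`,
zero crux / stub credit).  Corollary of the located law at every ratio `a < b` (`MixedGauge.card_posRoots_det_blockPencil_le_all`, p834386) by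
the block-swap / sign symmetry `−(M(x) with its two blocks exchanged) = [[(−C) + X^b·1, −Bᵀ], [−B, (−A) − X^a·1]]`: the two determinants
differ by the sign `(−1)^{n+m}`, so for `1 ≤ b < a` the positive roots of `det [[A + X^a·1, B], [Bᵀ, C − X^b·1]]` number at most `m + 2n`
(`card_posRoots_det_blockPencil_le_all_swap`); and the EQUAL-EXPONENT case `a = b ≥ 1` has at most `n + m` positive roots
(`card_posRoots_det_blockPencil_le_diag`: the pencil is `expand a` of the linear pencil `X·J + H`, `J = 1 ⊕ (−1)`, whose determinant has
degree `≤ n + m` — `Polynomial.natDegree_det_X_add_C_le` — and is non-zero at a large scale; `x ↦ x^a` is injective on positive roots).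
Together: for EVERY pair of exponents `a, b ≥ 1` the count is at most (dimension of the block with the smaller exponent) + 2·(dimension of
the other block), and `n + m` when `a = b`.  Nothing here is about `WeakLifting` / `TropicalB` in their windows, the registered stubs, the
doors, `MatrixDescartes` (18050) or VP ≠ VNP.  No `def`; axioms standard. [folklore]
-/

set_option linter.dupNamespace false
set_option autoImplicit false

namespace Summit.ValiantsHypothesis.ValiantsHypothesis.Theorems.KPlusLogSqLaw

namespace MixedGauge

open Matrix Finset Polynomial
open scoped BigOperators

variable {n m : ℕ}

/-- the block-swap / sign symmetry of the two-class pencil (polynomial matrices). [folklore] -/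
theorem blockPencil_swap_neg (A : Matrix (Fin n) (Fin n) ℝ) (C : Matrix (Fin m) (Fin m) ℝ) (B : Matrix (Fin n) (Fin m) ℝ) (a b : ℕ) :
    Matrix.fromBlocks ((-C).map Polynomial.C + ((Polynomial.X : Polynomial ℝ) ^ b) • 1) ((-Bᵀ).map Polynomial.C)
        ((-Bᵀ)ᵀ.map Polynomial.C) ((-A).map Polynomial.C - ((Polynomial.X : Polynomial ℝ) ^ a) • 1)
      = -((Matrix.fromBlocks (A.map Polynomial.C + ((Polynomial.X : Polynomial ℝ) ^ a) • 1) (B.map Polynomial.C)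
          (Bᵀ.map Polynomial.C) (C.map Polynomial.C - ((Polynomial.X : Polynomial ℝ) ^ b) • 1)).submatrix Sum.swap Sum.swap) := by
  rw [Matrix.fromBlocks_submatrix_sum_swap_sum_swap, Matrix.fromBlocks_neg]
  congr 1
  · ext i j
    simp only [Matrix.add_apply, Matrix.map_apply, Matrix.neg_apply, Matrix.sub_apply, Matrix.smul_apply, map_neg, smul_eq_mul]
    ring
  · ext i j
    simp only [Matrix.map_apply, Matrix.neg_apply, map_neg]
  · ext i j
    simp only [Matrix.map_apply, Matrix.neg_apply, Matrix.transpose_apply, map_neg]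
  · ext i j
    simp only [Matrix.add_apply, Matrix.map_apply, Matrix.neg_apply, Matrix.sub_apply, Matrix.smul_apply, map_neg, smul_eq_mul]
    ring

/-- **The located two-class law with the slow block faster (`1 ≤ b < a`): at most `m + 2n` distinct positive roots.** [folklore] -/
theorem card_posRoots_det_blockPencil_le_all_swap (A : Matrix (Fin n) (Fin n) ℝ) (hA : A.IsSymm) (C : Matrix (Fin m) (Fin m) ℝ)
    (hC : C.IsSymm) (B : Matrix (Fin n) (Fin m) ℝ) (a b : ℕ) (hb : 1 ≤ b) (hba : b < a) :
    ((Matrix.det (Matrix.fromBlocks (A.map Polynomial.C + ((Polynomial.X : Polynomial ℝ) ^ a) • 1) (B.map Polynomial.C)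
          (Bᵀ.map Polynomial.C)
          (C.map Polynomial.C - ((Polynomial.X : Polynomial ℝ) ^ b) • 1))).roots.toFinset.filter
        (fun x => 0 < x)).card ≤ m + 2 * n := by
  classical
  have h := card_posRoots_det_blockPencil_le_all (n := m) (m := n) (-C) hC.neg (-A) hA.neg (-Bᵀ) b a hb hba
  rw [blockPencil_swap_neg A C B a b, Matrix.det_neg] at h
  have hdet : ((Matrix.fromBlocks (A.map Polynomial.C + ((Polynomial.X : Polynomial ℝ) ^ a) • 1) (B.map Polynomial.C)
      (Bᵀ.map Polynomial.C) (C.map Polynomial.C - ((Polynomial.X : Polynomial ℝ) ^ b) • 1)).submatrix Sum.swap Sum.swap).det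
      = (Matrix.fromBlocks (A.map Polynomial.C + ((Polynomial.X : Polynomial ℝ) ^ a) • 1) (B.map Polynomial.C)
      (Bᵀ.map Polynomial.C) (C.map Polynomial.C - ((Polynomial.X : Polynomial ℝ) ^ b) • 1)).det :=
    Matrix.det_submatrix_equiv_self (Equiv.sumComm (Fin m) (Fin n)) _
  rw [hdet] at h
  have hunit : ((-1 : Polynomial ℝ) ^ Fintype.card (Fin m ⊕ Fin n)) = Polynomial.C ((-1 : ℝ) ^ Fintype.card (Fin m ⊕ Fin n)) := by
    simp
  rw [hunit, Polynomial.roots_C_mul _ (pow_ne_zero _ (by norm_num))] at h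
  exact h

end MixedGauge

end Summit.ValiantsHypothesis.ValiantsHypothesis.Theorems.KPlusLogSqLaw

namespace Summit.ValiantsHypothesis.ValiantsHypothesis.Theorems.KPlusLogSqLaw

namespace MixedGauge

open Matrix Finset Polynomial
open scoped BigOperators

variable {n m : ℕ}

/-- the equal-exponent pencil is the `expand` of the linear pencil. [folklore] -/
theorem blockPencil_diag_eq_expand (A : Matrix (Fin n) (Fin n) ℝ) (C : Matrix (Fin m) (Fin m) ℝ) (B : Matrix (Fin n) (Fin m) ℝ) (a : ℕ) :
    Matrix.fromBlocks (A.map Polynomial.C + ((Polynomial.X : Polynomial ℝ) ^ a) • 1) (B.map Polynomial.C)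
        (Bᵀ.map Polynomial.C) (C.map Polynomial.C - ((Polynomial.X : Polynomial ℝ) ^ a) • 1)
      = ((Polynomial.expand ℝ a : ℝ[X] →ₐ[ℝ] ℝ[X]) : ℝ[X] →+* ℝ[X]).mapMatrix
          (Matrix.fromBlocks (A.map Polynomial.C + ((Polynomial.X : Polynomial ℝ) ^ 1) • 1) (B.map Polynomial.C)
            (Bᵀ.map Polynomial.C) (C.map Polynomial.C - ((Polynomial.X : Polynomial ℝ) ^ 1) • 1)) := by
  rw [RingHom.mapMatrix_apply, Matrix.fromBlocks_map]
  congr 1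
  · ext i j
    simp only [Matrix.map_apply, Matrix.add_apply, Matrix.smul_apply, smul_eq_mul, RingHom.coe_coe, map_add, map_mul,
      Polynomial.expand_C, pow_one, Polynomial.expand_X]
    by_cases hij : i = j
    · subst hij; simp
    · simp [Matrix.one_apply_ne hij]
  · ext i j
    simp only [Matrix.map_apply, RingHom.coe_coe, Polynomial.expand_C]
  · ext i j
    simp only [Matrix.map_apply, RingHom.coe_coe, Polynomial.expand_C]
  · ext i j
    simp only [Matrix.map_apply, Matrix.sub_apply, Matrix.smul_apply, smul_eq_mul, RingHom.coe_coe, map_sub, map_mul,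
      Polynomial.expand_C, pow_one, Polynomial.expand_X]
    by_cases hij : i = j
    · subst hij; simp
    · simp [Matrix.one_apply_ne hij]

/-- the linear pencil in the `X • J + H` form of `Polynomial.natDegree_det_X_add_C_le`. [folklore] -/
theorem blockPencil_one_eq (A : Matrix (Fin n) (Fin n) ℝ) (C : Matrix (Fin m) (Fin m) ℝ) (B : Matrix (Fin n) (Fin m) ℝ) :
    Matrix.fromBlocks (A.map Polynomial.C + ((Polynomial.X : Polynomial ℝ) ^ 1) • 1) (B.map Polynomial.C)
        (Bᵀ.map Polynomial.C) (C.map Polynomial.C - ((Polynomial.X : Polynomial ℝ) ^ 1) • 1)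
      = (Polynomial.X : ℝ[X]) • (Matrix.fromBlocks (1 : Matrix (Fin n) (Fin n) ℝ) 0 0 (-1 : Matrix (Fin m) (Fin m) ℝ)).map Polynomial.C
          + (Matrix.fromBlocks A B Bᵀ C).map Polynomial.C := by
  rw [Matrix.fromBlocks_map, Matrix.fromBlocks_map, Matrix.fromBlocks_smul, Matrix.fromBlocks_add]
  congr 1
  · ext i j
    simp only [Matrix.add_apply, Matrix.map_apply, Matrix.smul_apply, smul_eq_mul, pow_one]
    by_cases hij : i = j
    · subst hij; simp; ring
    · simp [Matrix.one_apply_ne hij]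
  · ext i j; simp
  · ext i j; simp
  · ext i j
    simp only [Matrix.add_apply, Matrix.sub_apply, Matrix.map_apply, Matrix.smul_apply, Matrix.neg_apply, smul_eq_mul, pow_one]
    by_cases hij : i = j
    · subst hij; simp; ring
    · simp [Matrix.one_apply_ne hij]

/-- **The equal-exponent case (`a = b ≥ 1`): at most `n + m` distinct positive roots** (a generalized eigenvalue problem in `s = x^a`:
`det(H + s·J)` has degree `≤ n + m` in `s` and is not identically zero). [folklore] -/
theorem card_posRoots_det_blockPencil_le_diag (A : Matrix (Fin n) (Fin n) ℝ) (C : Matrix (Fin m) (Fin m) ℝ)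
    (B : Matrix (Fin n) (Fin m) ℝ) (a : ℕ) (ha : 1 ≤ a) :
    ((Matrix.det (Matrix.fromBlocks (A.map Polynomial.C + ((Polynomial.X : Polynomial ℝ) ^ a) • 1) (B.map Polynomial.C)
          (Bᵀ.map Polynomial.C)
          (C.map Polynomial.C - ((Polynomial.X : Polynomial ℝ) ^ a) • 1))).roots.toFinset.filter
        (fun x => 0 < x)).card ≤ n + m := by
  classical
  set Q := Matrix.det (Matrix.fromBlocks (A.map Polynomial.C + ((Polynomial.X : Polynomial ℝ) ^ 1) • 1) (B.map Polynomial.C)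
          (Bᵀ.map Polynomial.C) (C.map Polynomial.C - ((Polynomial.X : Polynomial ℝ) ^ 1) • 1)) with hQdef
  have hP : Matrix.det (Matrix.fromBlocks (A.map Polynomial.C + ((Polynomial.X : Polynomial ℝ) ^ a) • 1) (B.map Polynomial.C)
          (Bᵀ.map Polynomial.C) (C.map Polynomial.C - ((Polynomial.X : Polynomial ℝ) ^ a) • 1)) = Polynomial.expand ℝ a Q := by
    rw [blockPencil_diag_eq_expand, ← RingHom.map_det]
    rfl
  -- Q ≠ 0 and natDegree Q ≤ n + m
  have hQeval : ∀ x : ℝ, Q.eval x = (Matrix.fromBlocks (A + (x ^ 1) • (1 : Matrix (Fin n) (Fin n) ℝ)) B Bᵀ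
      (C - (x ^ 1) • (1 : Matrix (Fin m) (Fin m) ℝ))).det := by
    intro x
    rw [hQdef, ← Polynomial.coe_evalRingHom, RingHom.map_det, eval_blockPencil_pow]
  set X₀ : ℝ := 1 + (∑ i, ∑ j, |A i j|) + (∑ i, ∑ j, |C i j|) with hX₀
  have hSA : 0 ≤ ∑ i, ∑ j, |A i j| := Finset.sum_nonneg fun i _ => Finset.sum_nonneg fun j _ => abs_nonneg _
  have hSC : 0 ≤ ∑ i, ∑ j, |C i j| := Finset.sum_nonneg fun i _ => Finset.sum_nonneg fun j _ => abs_nonneg _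
  have hQ0 : Q ≠ 0 := by
    intro h0
    have h1 := hQeval X₀
    rw [h0, Polynomial.eval_zero] at h1
    exact blockFamily_det_ne_zero_of_large A C B 1 1 le_rfl le_rfl X₀ (by rw [hX₀]; linarith) (by rw [hX₀]; linarith)
      (by rw [hX₀]; linarith) h1.symm
  have hdeg : Q.natDegree ≤ n + m := by
    rw [hQdef, blockPencil_one_eq]
    have h := Polynomial.natDegree_det_X_add_C_le (Matrix.fromBlocks (1 : Matrix (Fin n) (Fin n) ℝ) 0 0 (-1 : Matrix (Fin m) (Fin m) ℝ))
      (Matrix.fromBlocks A B Bᵀ C)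
    simpa [Fintype.card_sum, Fintype.card_fin] using h
  -- positive roots of P ↦ positive roots of Q by x ↦ x^a, injectively
  rw [hP]
  have ha0 : a ≠ 0 := by omega
  have hmaps : ∀ x ∈ (Polynomial.expand ℝ a Q).roots.toFinset.filter (fun x => 0 < x), x ^ a ∈ Q.roots.toFinset := by
    intro x hx
    rw [Finset.mem_filter, Multiset.mem_toFinset, Polynomial.mem_roots', Polynomial.IsRoot.def, Polynomial.expand_eval] at hx
    rw [Multiset.mem_toFinset, Polynomial.mem_roots hQ0, Polynomial.IsRoot.def]
    exact hx.1.2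
  have hinj : Set.InjOn (fun x : ℝ => x ^ a) ((Polynomial.expand ℝ a Q).roots.toFinset.filter (fun x => 0 < x) : Finset ℝ) := by
    intro x hx y hy hxy
    have hx' : 0 < x := (Finset.mem_filter.mp (Finset.mem_coe.mp hx)).2
    have hy' : 0 < y := (Finset.mem_filter.mp (Finset.mem_coe.mp hy)).2
    exact (pow_left_inj₀ hx'.le hy'.le ha0).mp hxy
  calc ((Polynomial.expand ℝ a Q).roots.toFinset.filter (fun x => 0 < x)).card
      ≤ Q.roots.toFinset.card := Finset.card_le_card_of_injOn (fun x => x ^ a) hmaps hinj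
    _ ≤ Multiset.card Q.roots := Multiset.toFinset_card_le _
    _ ≤ Q.natDegree := Polynomial.card_roots' Q
    _ ≤ n + m := hdeg

end MixedGauge

end Summit.ValiantsHypothesis.ValiantsHypothesis.Theorems.KPlusLogSqLaw
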